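import Summits.AtomisticToContinuum.Crystallization.Theorems.FrustratedLawDichotomyExemptDoor
import Summits.AtomisticToContinuum.Crystallization.Theorems.FrustratedLawDichotomySchurCutB

/-!
# FrustratedLawDichotomy · crux `AperiodicFrustratedLawGap` (stmt-AtomisticToContinuum-27623) — THE REMOVAL EXEMPTION:
# over-bound sites (`h_i > eUp + t`) are FREE, and the Schur-cut residual with exemptions
# (decomp-a2c, prover hand 2, structural share, generation 14; generic, radius-free)

Instance of the exemption door `FrustratedLawDichotomyExemptDoor` (`DeepAbsent M Ex ∧ ExemptFDG Ex ⟹` crux).  Sütő's removal test with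
ONE atom (`IsMuGSC.removal`, `n = 1`; tree: `FrustratedLawDichotomyGSCOneAtomTests.binding_le_of_isMuGSC`) says that every atom `p` of an
`e⋆`-μGSC `X` of `V_LJ` is bound by at least `−e⋆`: `h_p(X) = Σ'_{q ∈ X∖{p}} V_LJ(|p − q|) ≤ e⋆`.  Seen from a root-centred WINDOW
`xf = X ∩ B̄(0,r)`, a site `i` deeper than `M` misses only atoms farther than `M`, whose total field is at most the tree's far-field
constant `T(M) = ((10/7)⁶/12 + 1/6)·1024/((7/10)³M³)` (`FrustratedLawDichotomyGSCVanHoveBalls.abs_tsum_field_le_of_far`).  Hence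

* `siteEnergy_le_of_window`   : `siteEnergy V_LJ xf i ≤ e⋆ + T(M)` for every site with `‖xf i‖ + M ≤ r` (`M ≥ 7/10`);
* `RemovalUnstable eUp t`      : the site predicate «`eUp + t < siteEnergy V_LJ y i`» (the site is bound by LESS than `−(eUp + t)`);
* `deepAbsent_removalUnstable` : `e⋆ ≤ eUp ∧ 0 < t ⟹ DeepAbsent (removalDepth t) (RemovalUnstable eUp t)`
                                 (`removalDepth t = max 1 (K·1024/((7/10)³·t))`, so that `T(removalDepth t) ≤ t`);
* BY NAME: `aperiodicFrustratedLawGap_of_removalExempt` — `MuEquilibriumDoor ∧ UP(eUp) ∧ ExemptFDG (RemovalUnstable eUp t) ⟹` crux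
  (+ sibling 27624, + the REGISTERED STUB `stub_aperiodicErgodicGap`);
* the SCHUR-CUT residual WITH EXEMPTIONS `SchurRangeGapX w ω A e₁ C Ex` («`e₁·N − C·#{GoodAt(1/20) ∨ Ex} ≤ Σ W − A·N`») and its kernels
  `exemptFDG_of_schurCutX` (`SF ∧ e⋆ ≤ eUp ∧ FRG♭_X(e₁) ∧ eUp < e₁ ⟹ ExemptFDG Ex`), `aperiodicFrustratedLawGap_of_schurCutX`,
  and at the node of record (range `9/2`, `SF₄₅`, `UP(−0.7175)`, level `e₁ = −0.7174`):
  `aperiodicFrustratedLawGap_of_schurCutX_fourHalf` (any deep-absent `Ex`) / `aperiodicFrustratedLawGap_of_schurCut_removal_fourHalf`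
  (`Ex =` removal instability at `eUp = −0.7175`, any `t > 0`).

MEANING for the certificate programme (critic rows 526 (iii) / 527): a finite certificate beneath `T′♭₄₅ / FRG♭₄₅` may give an ARBITRARY
credit `C` to every site whose Lennard-Jones site energy inside the cluster exceeds `−0.7175 + t`; since `x` is bounded below on
`7/10`-separated clusters, a local rule that lets such a site keep `C/(k+1)` and send `C/(k+1)` to each of its `≤ k` neighbours within the
rule's range certifies the whole neighbourhood for `C` large — the hedgehog's shell (site energies `≫ 0`), compressed platelets / slabs with
`f ≲ 0.8` and every «absurd but `7/10`-legal» texture are no longer adversaries.  (Mild textures with all `h_i ≤ −0.7175 + t` remain; the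
one-move exemption of the sequel file addresses force imbalance.)  All `[folklore]` bookkeeping on landed lemmas.
-/

noncomputable section

namespace Summit.AtomisticToContinuum.Crystallization.Theorems.FrustratedLawDichotomyExemptRemoval

open Metric
open Literature.MathematicalPhysics.StatisticalMechanics
open Summit.AtomisticToContinuum.Crystallization.Theorems.ChargedEnergyGapNegative (E3 eStar)
open Summit.AtomisticToContinuum.Crystallization.Theorems.FrustratedLawDichotomyGSCClusterExactness
  (tsum_diff_singleton_eq_tsum tsum_eq_sum_add_tsum_diff)
open Summit.AtomisticToContinuum.Crystallization.Theorems.FrustratedLawDichotomyGSCVanHoveBalls (abs_tsum_field_le_of_far)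
open Summit.AtomisticToContinuum.Crystallization.Theorems.FrustratedLawDichotomyGSCOneAtomTests (binding_le_of_isMuGSC)
open Summit.AtomisticToContinuum.Crystallization.Theorems.FrustratedLawDichotomyExemptDoor
open Summit.AtomisticToContinuum.Crystallization.Theorems.FrustratedLawDichotomyRangeCut
  (Sep GoodAt FDG PeriodicEnergyCeiling eStar_le_of_periodicEnergyCeiling)
open Summit.AtomisticToContinuum.Crystallization.Theorems.FrustratedLawDichotomySchurCut
  (SchurFloor effPot le_interactionEnergy_of_schurFloor w₄₅ ω₄ SF₄₅)

/-! ## §1. The site energy of a deep window site of an exact μ-equilibrium -/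

/-- **The far-field constant `T(M)`** of the tree (`abs_tsum_field_le_of_far` at separation `7/10`, cut-off `M`):
`((10/7)⁶/12 + 1/6)·1024/((7/10)³·M³)`. -/
def tailConst (M : ℝ) : ℝ := ((7 / 10 : ℝ)⁻¹ ^ 6 / 12 + 1 / 6) * (1024 / ((7 / 10 : ℝ) ^ 3 * M ^ 3))

/-- `T(M) ≥ 0` for `M ≥ 0`. [folklore] -/
theorem tailConst_nonneg {M : ℝ} (hM : 0 ≤ M) : 0 ≤ tailConst M := by
  unfold tailConst; positivity

/-- The full sum `Σ_k V_LJ(|y_i − y_k|)` (diagonal included, `V_LJ(0) = 0`) is the site energy. [folklore] -/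
theorem sum_eq_siteEnergy {N : ℕ} (y : Fin N → EuclideanSpace ℝ (Fin 3)) (i : Fin N) :
    ∑ k, lennardJones (dist (y i) (y k)) = siteEnergy lennardJones y i := by
  rw [siteEnergy, ← Finset.add_sum_erase Finset.univ _ (Finset.mem_univ i), dist_self, lennardJones_zero, zero_add]

/-- **DEEP WINDOW SITES ARE HALF-BULK BOUND**: let `X` be a `7/10`-separated `e⋆`-μGSC of `V_LJ`, `xf` a window of `X`
(`range xf = X ∩ B̄(0,r)`, injective) and `i` a site with `‖xf i‖ + M ≤ r`, `M ≥ 7/10`.  Then the site energy of `i` INSIDE THE WINDOW is at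
most `e⋆ + T(M)`: the binding test `h_{xf i}(X) ≤ e⋆` loses only the field of the atoms outside the window, all farther than `M`.
[folklore] -/
theorem siteEnergy_le_of_window {X : Set (EuclideanSpace ℝ (Fin 3))}
    (hsep : ∀ a ∈ X, ∀ b ∈ X, a ≠ b → (7 : ℝ) / 10 ≤ dist a b) (hGSC : IsMuGSC lennardJones eStar X)
    {r : ℝ} {n : ℕ} {xf : Fin n → EuclideanSpace ℝ (Fin 3)} (hinj : Function.Injective xf)
    (hrange : Set.range xf = X ∩ closedBall 0 r) {M : ℝ} (hM : (7 : ℝ) / 10 ≤ M) {i : Fin n} (hi : ‖xf i‖ + M ≤ r) :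
    siteEnergy lennardJones xf i ≤ eStar + tailConst M := by
  have hsub : Set.range xf ⊆ X := hrange.le.trans Set.inter_subset_left
  have hp : xf i ∈ X := hsub ⟨i, rfl⟩
  have hb := binding_le_of_isMuGSC hGSC hp
  rw [tsum_diff_singleton_eq_tsum lennardJones_zero, tsum_eq_sum_add_tsum_diff hGSC.summable hinj hsub,
    sum_eq_siteEnergy] at hb
  have hsepY : ∀ a ∈ X \ Set.range xf, ∀ b ∈ X \ Set.range xf, a ≠ b → (7 : ℝ) / 10 ≤ dist a b :=
    fun a ha b hb' hab => hsep a ha.1 b hb'.1 hab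
  have hfar : ∀ y ∈ X \ Set.range xf, M ≤ dist (xf i) y := by
    intro y hy
    have hyr : r < ‖y‖ := by
      by_contra hle
      rw [not_lt] at hle
      exact hy.2 (by rw [hrange]; exact ⟨hy.1, mem_closedBall_zero_iff.2 hle⟩)
    have h1 : ‖y‖ - ‖xf i‖ ≤ dist (xf i) y := by
      rw [dist_comm, dist_eq_norm]
      exact norm_sub_norm_le y (xf i)
    linarith
  have hT := abs_tsum_field_le_of_far (Y := X \ Set.range xf) (by norm_num : (0 : ℝ) < 7 / 10) hsepY (xf i)
    (Rc := M) hM hfar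
  have hneg := neg_abs_le (∑' y : ↥(X \ Set.range xf), lennardJones (dist (xf i) y))
  unfold tailConst
  linarith

/-! ## §2. Removal instability is deep-absent -/

/-- **REMOVAL-UNSTABLE site** at ceiling `eUp` and threshold `t`: the Lennard-Jones site energy of `i` inside the cluster exceeds `eUp + t`
(the site is bound by less than `−(eUp + t)`; for `eUp ≥ e⋆` no deep atom of an exact μ-equilibrium is). -/
def RemovalUnstable (eUp t : ℝ) : SitePred := fun _ y i => eUp + t < siteEnergy lennardJones y i

/-- Unfolding lemma. [folklore] -/
theorem removalUnstable_iff (eUp t : ℝ) {N : ℕ} (y : Fin N → EuclideanSpace ℝ (Fin 3)) (i : Fin N) :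
    RemovalUnstable eUp t N y i ↔ eUp + t < siteEnergy lennardJones y i := Iff.rfl

/-- **The depth at which the far field drops below `t`**: `max 1 (K·1024/((7/10)³·t))`, `K = (10/7)⁶/12 + 1/6`. -/
def removalDepth (t : ℝ) : ℝ := max 1 (((7 / 10 : ℝ)⁻¹ ^ 6 / 12 + 1 / 6) * 1024 / ((7 / 10 : ℝ) ^ 3 * t))

/-- `removalDepth t ≥ 1`. [folklore] -/
theorem one_le_removalDepth (t : ℝ) : 1 ≤ removalDepth t := le_max_left _ _

/-- `T(removalDepth t) ≤ t` for `t > 0`. [folklore] -/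
theorem tailConst_removalDepth_le {t : ℝ} (ht : 0 < t) : tailConst (removalDepth t) ≤ t := by
  set K : ℝ := (7 / 10 : ℝ)⁻¹ ^ 6 / 12 + 1 / 6 with hK
  have hKpos : 0 < K := by rw [hK]; positivity
  set M : ℝ := removalDepth t with hMdef
  have hM1 : (1 : ℝ) ≤ M := one_le_removalDepth t
  have hMpos : 0 < M := by linarith
  have hMκ : K * 1024 / ((7 / 10 : ℝ) ^ 3 * t) ≤ M := le_max_right _ _
  have hsq : (1 : ℝ) ≤ M * M := by nlinarith
  have h3 : M ≤ M ^ 3 := by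
    calc M = M * 1 := (mul_one _).symm
      _ ≤ M * (M * M) := mul_le_mul_of_nonneg_left hsq hMpos.le
      _ = M ^ 3 := by ring
  have h4 : K * (1024 / ((7 / 10 : ℝ) ^ 3 * M ^ 3)) ≤ K * (1024 / ((7 / 10 : ℝ) ^ 3 * M)) := by
    refine mul_le_mul_of_nonneg_left ?_ hKpos.le
    exact div_le_div_of_nonneg_left (by norm_num) (by positivity) (mul_le_mul_of_nonneg_left h3 (by positivity))
  have h5 : K * (1024 / ((7 / 10 : ℝ) ^ 3 * M)) ≤ t := by
    have h2' : K * 1024 ≤ M * ((7 / 10 : ℝ) ^ 3 * t) := (div_le_iff₀ (by positivity)).1 hMκ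
    rw [mul_div_assoc', div_le_iff₀ (by positivity)]
    linarith
  show K * (1024 / ((7 / 10 : ℝ) ^ 3 * M ^ 3)) ≤ t
  linarith

/-- **REMOVAL INSTABILITY IS DEEP-ABSENT**: for `e⋆ ≤ eUp` and `t > 0`, no site deeper than `removalDepth t` inside a window of a rooted
`7/10`-separated `e⋆`-μGSC of `V_LJ` has site energy above `eUp + t`. [folklore] -/
theorem deepAbsent_removalUnstable {eUp t : ℝ} (hUp : eStar ≤ eUp) (ht : 0 < t) :
    DeepAbsent (removalDepth t) (RemovalUnstable eUp t) := by
  intro X _ hsep hGSC r n xf hinj hrange i hi hEx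
  have hM : (7 : ℝ) / 10 ≤ removalDepth t := le_trans (by norm_num) (one_le_removalDepth t)
  have h1 := siteEnergy_le_of_window hsep hGSC hinj hrange hM hi
  have h2 := tailConst_removalDepth_le ht
  rw [removalUnstable_iff] at hEx
  linarith

/-- The same for any upper bound certified by a periodic configuration (`UP(eUp)`). [folklore] -/
theorem deepAbsent_removalUnstable_of_up {eUp t : ℝ} (hU : PeriodicEnergyCeiling eUp) (ht : 0 < t) :
    DeepAbsent (removalDepth t) (RemovalUnstable eUp t) :=
  deepAbsent_removalUnstable (eStar_le_of_periodicEnergyCeiling hU) ht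

/-! ## §3. The crux, the sibling and the registered stub BY NAME from a removal-exempt price -/

/-- **`AperiodicFrustratedLawGap` BY NAME**: `MuEquilibriumDoor ∧ UP(eUp) ∧ ExemptFDG (RemovalUnstable eUp t)` (`t > 0`) `⟹` crux —
over-bound sites are free. [folklore] -/
theorem aperiodicFrustratedLawGap_of_removalExempt
    (hDoor : Summit.AtomisticToContinuum.Crystallization.Theses.GrainCoreNetworkSplit.MuEquilibriumDoor)
    {eUp t : ℝ} (hU : PeriodicEnergyCeiling eUp) (ht : 0 < t) (h : ExemptFDG (RemovalUnstable eUp t)) :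
    Summit.AtomisticToContinuum.Crystallization.Theses.FrustratedLawDichotomy.AperiodicFrustratedLawGap :=
  aperiodicFrustratedLawGap_of_exemptFDG hDoor (deepAbsent_removalUnstable_of_up hU ht) h

/-- **`PeriodicFrustratedLawGap` (item 27624) BY NAME** from the same removal-exempt price. [folklore] -/
theorem periodicFrustratedLawGap_of_removalExempt
    (hDoor : Summit.AtomisticToContinuum.Crystallization.Theses.GrainCoreNetworkSplit.MuEquilibriumDoor)
    {eUp t : ℝ} (hU : PeriodicEnergyCeiling eUp) (ht : 0 < t) (h : ExemptFDG (RemovalUnstable eUp t)) :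
    Summit.AtomisticToContinuum.Crystallization.Theses.FrustratedLawDichotomy.PeriodicFrustratedLawGap :=
  periodicFrustratedLawGap_of_exemptFDG hDoor (deepAbsent_removalUnstable_of_up hU ht) h

/-! ## §4. The Schur-cut residual WITH EXEMPTIONS and its kernels -/

/-- **FRG♭ with exemptions `SchurRangeGapX w ω A e₁ C Ex`**: over injective `7/10`-separated clusters the finite-range energy `Σ W − A·N`
(`W = effPot w ω A`) lies above `e₁·N` up to `C` per `1/20`-good OR `Ex`-site. (`SchurRangeGap w ω A e₁ C` is the case `Ex = ⊥`.) -/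
def SchurRangeGapX (w ω : ℝ → ℝ) (A e₁ C : ℝ) (Ex : SitePred) : Prop :=
  ∀ (N : ℕ) (y : Fin N → EuclideanSpace ℝ (Fin 3)), Function.Injective y → Sep y →
    e₁ * N - C * (Nat.card {i : Fin N // GoodAt (1 / 20) y i ∨ Ex N y i} : ℝ) ≤ interactionEnergy (effPot w ω A) y - A * N

/-- **KERNEL**: `SF(w, ω, A) ∧ e⋆ ≤ eUp ∧ FRG♭_X(e₁, C, Ex) ∧ eUp < e₁ ⟹ ExemptFDG Ex` (rate `κ = e₁ − eUp`). [folklore] -/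
theorem exemptFDG_of_schurCutX' {w ω : ℝ → ℝ} {A eUp e₁ C : ℝ} {Ex : SitePred} (hF : SchurFloor w ω A)
    (hst : eStar ≤ eUp) (hG : SchurRangeGapX w ω A e₁ C Ex) (he : eUp < e₁) : ExemptFDG Ex := by
  refine ⟨e₁ - eUp, sub_pos.mpr he, C, fun N y hy hsep => ?_⟩
  have h1 := le_interactionEnergy_of_schurFloor hF y
  have h2 := hG N y hy hsep
  have hN : (N : ℝ) * eStar ≤ N * eUp := mul_le_mul_of_nonneg_left hst (Nat.cast_nonneg N)
  linarith

/-- **KERNEL**: `SF ∧ UP(eUp) ∧ FRG♭_X(e₁, C, Ex) ∧ eUp < e₁ ⟹ ExemptFDG Ex`. [folklore] -/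
theorem exemptFDG_of_schurCutX {w ω : ℝ → ℝ} {A eUp e₁ C : ℝ} {Ex : SitePred} (hF : SchurFloor w ω A)
    (hU : PeriodicEnergyCeiling eUp) (hG : SchurRangeGapX w ω A e₁ C Ex) (he : eUp < e₁) : ExemptFDG Ex :=
  exemptFDG_of_schurCutX' hF (eStar_le_of_periodicEnergyCeiling hU) hG he

/-- **THE NODE WITH EXEMPTIONS, crux form**: `MuEquilibriumDoor ∧ SF ∧ UP(eUp) ∧ DeepAbsent M Ex ∧ FRG♭_X(e₁, C, Ex) ∧ eUp < e₁ ⟹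
AperiodicFrustratedLawGap`. [folklore] -/
theorem aperiodicFrustratedLawGap_of_schurCutX {w ω : ℝ → ℝ} {A eUp e₁ C M : ℝ} {Ex : SitePred}
    (hDoor : Summit.AtomisticToContinuum.Crystallization.Theses.GrainCoreNetworkSplit.MuEquilibriumDoor)
    (hF : SchurFloor w ω A) (hU : PeriodicEnergyCeiling eUp) (hEx : DeepAbsent M Ex)
    (hG : SchurRangeGapX w ω A e₁ C Ex) (he : eUp < e₁) :
    Summit.AtomisticToContinuum.Crystallization.Theses.FrustratedLawDichotomy.AperiodicFrustratedLawGap :=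
  aperiodicFrustratedLawGap_of_exemptFDG hDoor hEx (exemptFDG_of_schurCutX hF hU hG he)

/-- **At the node of record (range `9/2`)**: `MuEquilibriumDoor ∧ SF₄₅ ∧ UP(−0.7175) ∧ DeepAbsent M Ex ∧ FRG♭_X(w₄₅, ω₄, 3/400; e₁, C, Ex)
∧ −0.7175 < e₁ ⟹` crux, for ANY deep-absent exemption `Ex`. [folklore] -/
theorem aperiodicFrustratedLawGap_of_schurCutX_fourHalf {e₁ C M : ℝ} {Ex : SitePred}
    (hDoor : Summit.AtomisticToContinuum.Crystallization.Theses.GrainCoreNetworkSplit.MuEquilibriumDoor)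
    (hF : SF₄₅) (hU : PeriodicEnergyCeiling (-(7175 / 10000))) (hEx : DeepAbsent M Ex)
    (hG : SchurRangeGapX w₄₅ ω₄ (3 / 400) e₁ C Ex) (he : -(7175 / 10000 : ℝ) < e₁) :
    Summit.AtomisticToContinuum.Crystallization.Theses.FrustratedLawDichotomy.AperiodicFrustratedLawGap :=
  aperiodicFrustratedLawGap_of_schurCutX hDoor hF hU hEx hG he

/-- **At the node of record with the REMOVAL exemption**: `MuEquilibriumDoor ∧ SF₄₅ ∧ UP(−0.7175) ∧
FRG♭_X(w₄₅, ω₄, 3/400; −0.7174, C, RemovalUnstable (−0.7175) t)` (`t > 0`) `⟹` crux — every finite injective `7/10`-separated cluster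
satisfies `−0.7174·N − C·#{1/20-good or site energy > −0.7175 + t} ≤ Σ_{i<j} W₄₅(r_ij) − (3/400)·N`. [folklore] -/
theorem aperiodicFrustratedLawGap_of_schurCut_removal_fourHalf {t C : ℝ}
    (hDoor : Summit.AtomisticToContinuum.Crystallization.Theses.GrainCoreNetworkSplit.MuEquilibriumDoor)
    (hF : SF₄₅) (hU : PeriodicEnergyCeiling (-(7175 / 10000))) (ht : 0 < t)
    (hG : SchurRangeGapX w₄₅ ω₄ (3 / 400) (-(7174 / 10000)) C (RemovalUnstable (-(7175 / 10000)) t)) :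
    Summit.AtomisticToContinuum.Crystallization.Theses.FrustratedLawDichotomy.AperiodicFrustratedLawGap :=
  aperiodicFrustratedLawGap_of_schurCutX_fourHalf hDoor hF hU (deepAbsent_removalUnstable_of_up hU ht) hG (by norm_num)

end Summit.AtomisticToContinuum.Crystallization.Theorems.FrustratedLawDichotomyExemptRemoval

end
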